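import Mathlib.Analysis.Matrix.Spectrum
import Mathlib.LinearAlgebra.UnitaryGroup
import Mathlib.Topology.Instances.Matrix
import Mathlib.Topology.Order.Compact
import Mathlib.Topology.MetricSpace.ProperSpace.Real
import Mathlib.Analysis.SpecialFunctions.Pow.Real
import Literature.Analysis.Matrix.DiagonallyDominantDyads
import HarnessLib

/-!
# The Motzkin–Wasow lemma (Gilbarg–Trudinger, Lemma 17.13) — ingredients

Towards: *there is a finite set of unit vectors `γ_1,…,γ_N ∈ ℝⁿ` and `0 < λ* ≤ Λ*`, depending
only on `n, λ, Λ`, such that every symmetric `𝒜` with `λ|x|² ≤ xᵀ𝒜x ≤ Λ|x|²` is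
`Σ β_k γ_k⊗γ_k` with `λ* ≤ β_k ≤ Λ*`.* The route (unit NOTES): (i) spectral decomposition with
eigenvalue bounds; (ii) a finite entrywise `ε`-net of the orthogonal group (compactness);
(iii) in a net frame `ε`-close to an eigenframe the matrix is nearly diagonal; (iv) the dyadic
pairing identity (`DiagonallyDominantDyads`); (v)–(vi) shift and reassembly. This file proves
(i), (ii) and (iii):

* `exists_orthogonal_diagonalization` — `𝒜 = U diag(d) Uᵀ`, `UᵀU = 1`, `λ ≤ d_k ≤ Λ`;
* `entry_abs_le_one_of_orthogonal` — `|U_ij| ≤ 1` for `UᵀU = 1`;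
* `isCompact_orthogonalSet`, `exists_finite_net_orthogonal` — the orthogonal matrices form a
  compact set, hence for every `ε > 0` there is a finite set `t` of orthogonal matrices with every
  orthogonal `U` entrywise `ε`-close to some `V ∈ t`;
* `near_diagonal` — `|(Vᵀ𝒜V)_pq − d_pδ_pq| ≤ Λ(2Nε + N(Nε)²)` for `V` entrywise `ε`-close to
  an eigenframe `U` of `𝒜`.

## References

* D. Gilbarg, N. S. Trudinger, *Elliptic Partial Differential Equations of Second Order* (2001),
  Lemma 17.13, pp. 456, 462. [GilbargTrudinger2001]
* T. S. Motzkin, W. Wasow, J. Math. Phys. 31 (1952) 253–259. [MotzkinWasow1952]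
-/

noncomputable section

open Matrix Finset Set

namespace Literature.Analysis.Matrix.MotzkinWasow

variable {n : Type*} [Fintype n] [DecidableEq n]

/-! ### (i) Spectral decomposition with eigenvalue bounds -/

omit [DecidableEq n] in
/-- The squared Euclidean length as a dot product is the sum of squares. [folklore] -/
theorem dotProduct_self_eq_sum_sq (x : n → ℝ) : x ⬝ᵥ x = ∑ i, x i ^ 2 := by
  simp [dotProduct, sq]

/-- **Spectral decomposition with eigenvalue bounds**: a real symmetric `𝒜` with
`λ (x·x) ≤ x·𝒜x ≤ Λ (x·x)` is `U diag(d) Uᵀ` with `UᵀU = 1 = UUᵀ` and `λ ≤ d_k ≤ Λ`.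
[cite: GilbargTrudinger2001, Lemma 17.13 (the set `S[λ, Λ]`)] -/
theorem exists_orthogonal_diagonalization (A : Matrix n n ℝ) (hA : A.IsSymm) {lam Lam : ℝ}
    (hform : ∀ x : n → ℝ, lam * (x ⬝ᵥ x) ≤ x ⬝ᵥ (A *ᵥ x) ∧ x ⬝ᵥ (A *ᵥ x) ≤ Lam * (x ⬝ᵥ x)) :
    ∃ (U : Matrix n n ℝ) (d : n → ℝ), Uᵀ * U = 1 ∧ U * Uᵀ = 1 ∧ (∀ k, lam ≤ d k ∧ d k ≤ Lam) ∧
      A = U * diagonal d * Uᵀ := by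
  have hH : A.IsHermitian := by
    rw [Matrix.IsHermitian, conjTranspose_eq_transpose_of_trivial]
    exact hA
  set U : Matrix n n ℝ := (hH.eigenvectorUnitary : Matrix n n ℝ) with hU
  have hUmem := (hH.eigenvectorUnitary).2
  rw [Matrix.mem_unitaryGroup_iff'] at hUmem
  have hUmem' := (hH.eigenvectorUnitary).2
  rw [Matrix.mem_unitaryGroup_iff] at hUmem'
  have hstar : star U = Uᵀ := by
    rw [star_eq_conjTranspose, conjTranspose_eq_transpose_of_trivial]
  refine ⟨U, hH.eigenvalues, ?_, ?_, fun k ↦ ?_, ?_⟩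
  · rw [← hstar]; exact hUmem
  · rw [← hstar]; exact hUmem'
  · -- `d_k = v_kᵀ A v_k` with `v_k` a unit vector
    set v : n → ℝ := WithLp.ofLp (hH.eigenvectorBasis k) with hv
    have h1 : hH.eigenvalues k = v ⬝ᵥ (A *ᵥ v) := by
      rw [hH.eigenvalues_eq]
      simp [hv]
    have h2 : v ⬝ᵥ v = 1 := by
      have h := (hH.eigenvectorBasis).orthonormal.1 k
      rw [EuclideanSpace.norm_eq] at h
      have h3 : ∑ j, (hH.eigenvectorBasis k) j ^ 2 = 1 := by
        have := congrArg (· ^ 2) h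
        simp only [one_pow] at this
        rw [Real.sq_sqrt (Finset.sum_nonneg fun j _ ↦ by positivity)] at this
        simpa using this
      rw [dotProduct_self_eq_sum_sq]
      simpa [hv] using h3
    have h := hform v
    rw [h2, mul_one, mul_one, ← h1] at h
    exact h
  · have h := hH.spectral_theorem
    rw [Unitary.conjStarAlgAut_apply] at h
    rw [← hU, hstar] at h
    simpa using h

/-! ### (ii) Compactness of the orthogonal matrices and finite entrywise nets -/

/-- Entries of an orthogonal matrix are bounded by `1` (columns are unit vectors). [folklore] -/
theorem entry_abs_le_one_of_orthogonal {U : Matrix n n ℝ} (hU : Uᵀ * U = 1) (i j : n) :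
    |U i j| ≤ 1 := by
  have hcol : ∑ k, U k j ^ 2 = 1 := by
    have h := congrFun (congrFun hU j) j
    simp only [mul_apply, transpose_apply, one_apply_eq] at h
    simpa [sq] using h
  have h1 : U i j ^ 2 ≤ 1 := by
    rw [← hcol]
    exact Finset.single_le_sum (fun k _ ↦ sq_nonneg (U k j)) (mem_univ i)
  have h2 : |U i j| ^ 2 ≤ 1 ^ 2 := by rw [sq_abs, one_pow]; exact h1
  exact (pow_le_pow_iff_left₀ (abs_nonneg _) zero_le_one two_ne_zero).1 h2

/-- The set of orthogonal matrices `{U | UᵀU = 1}` is closed. [folklore] -/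
theorem isClosed_orthogonalSet : IsClosed {U : Matrix n n ℝ | Uᵀ * U = 1} := by
  have hc : Continuous fun U : Matrix n n ℝ ↦ Uᵀ * U :=
    (continuous_id.matrix_transpose).matrix_mul continuous_id
  exact isClosed_eq hc continuous_const

/-- **The orthogonal matrices form a compact set** (closed, inside the compact box
`[-1, 1]^{n×n}`). [folklore] -/
theorem isCompact_orthogonalSet : IsCompact {U : Matrix n n ℝ | Uᵀ * U = 1} := by
  have hbox : IsCompact (Set.pi Set.univ fun _ : n ↦ Set.pi Set.univ fun _ : n ↦ Set.Icc (-1 : ℝ) 1) :=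
    isCompact_univ_pi fun _ ↦ isCompact_univ_pi fun _ ↦ isCompact_Icc
  refine hbox.of_isClosed_subset isClosed_orthogonalSet fun U hU ↦ ?_
  simp only [Set.mem_pi, Set.mem_univ, Set.mem_Icc, forall_const]
  exact fun i j ↦ abs_le.1 (entry_abs_le_one_of_orthogonal hU i j)

/-- **Finite entrywise `ε`-nets of the orthogonal matrices**: for `ε > 0` there is a finite set
`t` of orthogonal matrices such that every orthogonal `U` is entrywise `ε`-close to some
`V ∈ t`; any prescribed orthogonal `V₀` (e.g. `1`) may be included.
[cite: GilbargTrudinger2001, Lemma 17.13 (proof: compactness and a finite subcover)] -/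
theorem exists_finite_net_orthogonal {ε : ℝ} (hε : 0 < ε) (V₀ : Matrix n n ℝ)
    (hV₀ : V₀ᵀ * V₀ = 1) :
    ∃ t : Finset (Matrix n n ℝ), V₀ ∈ t ∧ (∀ V ∈ t, Vᵀ * V = 1) ∧
      ∀ U : Matrix n n ℝ, Uᵀ * U = 1 → ∃ V ∈ t, ∀ i j, |U i j - V i j| < ε := by
  classical
  -- open cover of the compact set by entrywise `ε`-boxes around its points
  set O : Matrix n n ℝ → Set (Matrix n n ℝ) := fun V ↦ {U | ∀ i j, |U i j - V i j| < ε} with hO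
  have hOopen : ∀ V, IsOpen (O V) := fun V ↦ by
    have : O V = ⋂ i, ⋂ j, {U : Matrix n n ℝ | |U i j - V i j| < ε} := by
      ext U; simp [hO]
    rw [this]
    refine isOpen_iInter_of_finite fun i ↦ isOpen_iInter_of_finite fun j ↦ ?_
    have hc : Continuous fun U : Matrix n n ℝ ↦ |U i j - V i j| :=
      ((continuous_apply_apply i j).sub continuous_const).abs
    exact isOpen_lt hc continuous_const
  have hcover : {U : Matrix n n ℝ | Uᵀ * U = 1} ⊆ ⋃ V ∈ {U : Matrix n n ℝ | Uᵀ * U = 1}, O V :=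
    fun U hU ↦ Set.mem_biUnion hU (by simp [hO, hε])
  obtain ⟨t₀, ht₀sub, ht₀fin, ht₀cover⟩ :=
    isCompact_orthogonalSet.elim_finite_subcover_image (fun V _ ↦ hOopen V) hcover
  refine ⟨insert V₀ ht₀fin.toFinset, Finset.mem_insert_self _ _, ?_, fun U hU ↦ ?_⟩
  · intro V hV
    rcases Finset.mem_insert.1 hV with rfl | hV
    · exact hV₀
    · exact ht₀sub (ht₀fin.mem_toFinset.1 hV)
  · obtain ⟨V, hVt, hUV⟩ := Set.mem_iUnion₂.1 (ht₀cover hU)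
    exact ⟨V, Finset.mem_insert_of_mem (ht₀fin.mem_toFinset.2 hVt), hUV⟩


/-! ### (iii) In a frame entrywise close to an eigenframe the matrix is nearly diagonal -/

/-- Entries of `Uᵀ(V − U)` are `≤ (#n) ε` when `|U_ij| ≤ 1` and `|U_ij − V_ij| ≤ ε`. [folklore] -/
theorem entry_transpose_mul_sub_le {U V : Matrix n n ℝ} (hU : Uᵀ * U = 1) {ε : ℝ}
    (hUV : ∀ i j, |U i j - V i j| ≤ ε) (k p : n) :
    |(Uᵀ * (V - U)) k p| ≤ Fintype.card n * ε := by
  rw [mul_apply]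
  calc |∑ i, Uᵀ k i * (V - U) i p| ≤ ∑ i, |Uᵀ k i * (V - U) i p| := abs_sum_le_sum_abs _ _
    _ ≤ ∑ _i : n, ε := Finset.sum_le_sum fun i _ ↦ by
        rw [abs_mul, transpose_apply, Matrix.sub_apply, abs_sub_comm (V i p) (U i p)]
        calc |U i k| * |U i p - V i p| ≤ 1 * ε :=
              mul_le_mul (entry_abs_le_one_of_orthogonal hU i k) (hUV i p) (abs_nonneg _)
                zero_le_one
          _ = ε := one_mul ε
    _ = Fintype.card n * ε := by rw [sum_const, nsmul_eq_mul, Finset.card_univ]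

/-- **Near-diagonalisation in a nearby orthogonal frame**: if `𝒜 = U diag(d) Uᵀ` with `U`
orthogonal, `|d_k| ≤ Λ`, and `V` is orthogonal with `|U_ij − V_ij| ≤ ε`, then
`|(Vᵀ𝒜V)_pq − d_p δ_pq| ≤ Λ(2Nε + N(Nε)²)`, `N = #n`
(`Vᵀ𝒜V = (1+E)ᵀ diag(d) (1+E)` with `E = Uᵀ(V−U)`, `|E_kp| ≤ Nε`).
[cite: GilbargTrudinger2001, Lemma 17.13 (proof)] -/
theorem near_diagonal {A U V : Matrix n n ℝ} {d : n → ℝ} (hU : Uᵀ * U = 1)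
    (hV : Vᵀ * V = 1) {Lam ε : ℝ} (hd : ∀ k, |d k| ≤ Lam) (hε : 0 ≤ ε)
    (hUV : ∀ i j, |U i j - V i j| ≤ ε) (hA : A = U * diagonal d * Uᵀ) (p q : n) :
    |(Vᵀ * A * V) p q - diagonal d p q| ≤
      Lam * (2 * (Fintype.card n * ε) + Fintype.card n * (Fintype.card n * ε) ^ 2) := by
  have _hV := hV
  set E : Matrix n n ℝ := Uᵀ * (V - U) with hE
  set N : ℝ := (Fintype.card n : ℝ) with hN
  have hLam : 0 ≤ Lam := (abs_nonneg _).trans (hd p)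
  have hEb : ∀ k r, |E k r| ≤ N * ε := fun k r ↦ entry_transpose_mul_sub_le hU hUV k r
  have hNε : 0 ≤ N * ε := mul_nonneg (by positivity) hε
  -- `Uᵀ V = 1 + E` and `Vᵀ A V = (1 + E)ᵀ diag(d) (1 + E)`
  have hW : Uᵀ * V = 1 + E := by
    rw [hE, Matrix.mul_sub, hU]; abel
  have hB : Vᵀ * A * V = (1 + E)ᵀ * diagonal d * (1 + E) := by
    rw [← hW, hA, transpose_mul, transpose_transpose]
    simp only [Matrix.mul_assoc]
  have hexp : (1 + E)ᵀ * diagonal d * (1 + E) =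
      diagonal d + diagonal d * E + Eᵀ * diagonal d + Eᵀ * diagonal d * E := by
    simp only [transpose_add, transpose_one, Matrix.add_mul, Matrix.one_mul, Matrix.mul_add,
      Matrix.mul_one]
    abel
  rw [hB, hexp]
  simp only [Matrix.add_apply]
  -- the three error terms
  have h1 : |(diagonal d * E) p q| ≤ Lam * (N * ε) := by
    rw [diagonal_mul, abs_mul]
    exact mul_le_mul (hd p) (hEb p q) (abs_nonneg _) hLam
  have h2 : |(Eᵀ * diagonal d) p q| ≤ Lam * (N * ε) := by
    rw [mul_diagonal, transpose_apply, abs_mul, mul_comm]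
    exact mul_le_mul (hd q) (hEb q p) (abs_nonneg _) hLam
  have h3 : |(Eᵀ * diagonal d * E) p q| ≤ Lam * (N * (N * ε) ^ 2) := by
    rw [mul_apply]
    calc |∑ k, (Eᵀ * diagonal d) p k * E k q| ≤ ∑ k, |(Eᵀ * diagonal d) p k * E k q| :=
          abs_sum_le_sum_abs _ _
      _ ≤ ∑ _k : n, Lam * (N * ε) ^ 2 := Finset.sum_le_sum fun k _ ↦ by
          rw [mul_diagonal, transpose_apply, abs_mul, abs_mul]
          calc |E k p| * |d k| * |E k q| ≤ (N * ε) * Lam * (N * ε) :=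
                mul_le_mul (mul_le_mul (hEb k p) (hd k) (abs_nonneg _) hNε) (hEb k q)
                  (abs_nonneg _) (mul_nonneg hNε hLam)
            _ = Lam * (N * ε) ^ 2 := by ring
      _ = Lam * (N * (N * ε) ^ 2) := by
          rw [sum_const, nsmul_eq_mul, Finset.card_univ, ← hN]; ring
  calc |diagonal d p q + (diagonal d * E) p q + (Eᵀ * diagonal d) p q +
          (Eᵀ * diagonal d * E) p q - diagonal d p q|
      = |(diagonal d * E) p q + (Eᵀ * diagonal d) p q + (Eᵀ * diagonal d * E) p q| := by
        congr 1; ring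
    _ ≤ |(diagonal d * E) p q| + |(Eᵀ * diagonal d) p q| + |(Eᵀ * diagonal d * E) p q| :=
        (abs_add_le _ _).trans (by gcongr; exact abs_add_le _ _)
    _ ≤ Lam * (N * ε) + Lam * (N * ε) + Lam * (N * (N * ε) ^ 2) := by linarith
    _ = Lam * (2 * (N * ε) + N * (N * ε) ^ 2) := by ring


/-! ### Directions attached to an orthogonal frame and their pairings -/

/-- The off-diagonal index pairs `p ≠ q`. [folklore] -/
abbrev OffDiag (n : Type*) := {pq : n × n // pq.1 ≠ pq.2}

/-- The `n + 2·#OffDiag` directions attached to a frame `V`: the columns `V e_p` and the unit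
vectors `(V e_p ± V e_q)/√2`, `p ≠ q`. [cite: GilbargTrudinger2001, Lemma 17.13] -/
def dir (V : Matrix n n ℝ) : n ⊕ OffDiag n ⊕ OffDiag n → (n → ℝ)
  | Sum.inl p => fun i ↦ V i p
  | Sum.inr (Sum.inl pq) => fun i ↦ (1 / Real.sqrt 2) * (V i pq.1.1 + V i pq.1.2)
  | Sum.inr (Sum.inr pq) => fun i ↦ (1 / Real.sqrt 2) * (V i pq.1.1 - V i pq.1.2)

/-- Columns of an orthogonal matrix pair to `δ`. [folklore] -/
theorem col_dotProduct_col {V : Matrix n n ℝ} (hV : Vᵀ * V = 1) (p q : n) :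
    (fun i ↦ V i p) ⬝ᵥ (fun i ↦ V i q) = if p = q then 1 else 0 := by
  have h := congrFun (congrFun hV p) q
  rw [mul_apply] at h
  simp only [transpose_apply] at h
  rw [one_apply] at h
  simpa [dotProduct] using h

/-- **The directions are unit vectors.** [cite: GilbargTrudinger2001, Lemma 17.13] -/
theorem dir_unit {V : Matrix n n ℝ} (hV : Vᵀ * V = 1) (k : n ⊕ OffDiag n ⊕ OffDiag n) :
    dir V k ⬝ᵥ dir V k = 1 := by
  have hc := col_dotProduct_col hV
  rcases k with p | ⟨⟨p, q⟩, hpq⟩ | ⟨⟨p, q⟩, hpq⟩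
  · simpa [dir] using hc p p
  · have hpp := hc p p; have hqq := hc q q; have hpq' := hc p q; have hqp := hc q p
    rw [if_pos rfl] at hpp hqq
    rw [if_neg hpq] at hpq'; rw [if_neg (Ne.symm hpq)] at hqp
    simp only [dotProduct] at hpp hqq hpq' hqp ⊢
    have h2 : Real.sqrt 2 ^ 2 = 2 := Real.sq_sqrt (by norm_num)
    have hs : (1 / Real.sqrt 2) ^ 2 = 1 / 2 := by rw [div_pow, one_pow, h2]
    calc ∑ i, dir V (Sum.inr (Sum.inl ⟨(p, q), hpq⟩)) i * dir V (Sum.inr (Sum.inl ⟨(p, q), hpq⟩)) i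
        = (1 / Real.sqrt 2) ^ 2 * (∑ i, V i p * V i p + ∑ i, V i q * V i q +
            (∑ i, V i p * V i q + ∑ i, V i q * V i p)) := by
          rw [← Finset.sum_add_distrib, ← Finset.sum_add_distrib, ← Finset.sum_add_distrib,
            Finset.mul_sum]
          exact Finset.sum_congr rfl fun i _ ↦ by simp only [dir]; ring
      _ = 1 := by rw [hpp, hqq, hpq', hqp, hs]; ring
  · have hpp := hc p p; have hqq := hc q q; have hpq' := hc p q; have hqp := hc q p
    rw [if_pos rfl] at hpp hqq
    rw [if_neg hpq] at hpq'; rw [if_neg (Ne.symm hpq)] at hqp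
    simp only [dotProduct] at hpp hqq hpq' hqp ⊢
    have h2 : Real.sqrt 2 ^ 2 = 2 := Real.sq_sqrt (by norm_num)
    have hs : (1 / Real.sqrt 2) ^ 2 = 1 / 2 := by rw [div_pow, one_pow, h2]
    calc ∑ i, dir V (Sum.inr (Sum.inr ⟨(p, q), hpq⟩)) i * dir V (Sum.inr (Sum.inr ⟨(p, q), hpq⟩)) i
        = (1 / Real.sqrt 2) ^ 2 * (∑ i, V i p * V i p + ∑ i, V i q * V i q -
            (∑ i, V i p * V i q + ∑ i, V i q * V i p)) := by
          rw [← Finset.sum_add_distrib, ← Finset.sum_add_distrib, ← Finset.sum_sub_distrib,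
            Finset.mul_sum]
          exact Finset.sum_congr rfl fun i _ ↦ by simp only [dir]; ring
      _ = 1 := by rw [hpp, hqq, hpq', hqp, hs]; ring

omit [DecidableEq n] in
/-- The conjugated test matrix `h' = VᵀhV` has entries `h'_pq = (Ve_p)·h(Ve_q)`. [folklore] -/
theorem conj_apply (V h : Matrix n n ℝ) (p q : n) :
    (Vᵀ * h * V) p q = (fun i ↦ V i p) ⬝ᵥ (h *ᵥ fun i ↦ V i q) := by
  simp only [mul_apply, transpose_apply, dotProduct, mulVec]
  simp only [Finset.sum_mul, Finset.mul_sum]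
  rw [Finset.sum_comm]
  exact Finset.sum_congr rfl fun i _ ↦ Finset.sum_congr rfl fun j _ ↦ by ring

omit [DecidableEq n] in
/-- Pairing of a sum / difference of two vectors. [folklore] -/
theorem pairing_add_sub (h : Matrix n n ℝ) (x y : n → ℝ) (c : ℝ) :
    (fun i ↦ c * (x i + y i)) ⬝ᵥ (h *ᵥ fun i ↦ c * (x i + y i)) =
      c ^ 2 * (x ⬝ᵥ (h *ᵥ x) + y ⬝ᵥ (h *ᵥ y) + x ⬝ᵥ (h *ᵥ y) + y ⬝ᵥ (h *ᵥ x)) ∧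
    (fun i ↦ c * (x i - y i)) ⬝ᵥ (h *ᵥ fun i ↦ c * (x i - y i)) =
      c ^ 2 * (x ⬝ᵥ (h *ᵥ x) + y ⬝ᵥ (h *ᵥ y) - x ⬝ᵥ (h *ᵥ y) - y ⬝ᵥ (h *ᵥ x)) := by
  have e1 : (fun i ↦ c * (x i + y i)) = c • (x + y) := by funext i; simp [Pi.add_apply, smul_eq_mul]
  have e2 : (fun i ↦ c * (x i - y i)) = c • (x - y) := by funext i; simp [Pi.sub_apply, smul_eq_mul]
  rw [e1, e2]
  simp only [mulVec_smul, mulVec_add, mulVec_sub, smul_dotProduct, dotProduct_smul, add_dotProduct,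
    sub_dotProduct, dotProduct_add, dotProduct_sub, smul_eq_mul]
  constructor <;> ring

/-- Reindexing the ordered off-diagonal pairs. [folklore] -/
theorem sum_erase_eq_sum_offDiag (f : n → n → ℝ) :
    ∑ p, ∑ q ∈ univ.erase p, f p q = ∑ pq : OffDiag n, f pq.1.1 pq.1.2 := by
  have h1 : ∑ p, ∑ q ∈ univ.erase p, f p q =
      ∑ pq ∈ (univ : Finset (n × n)).filter (fun pq ↦ pq.1 ≠ pq.2), f pq.1 pq.2 := by
    rw [Finset.sum_filter, ← Finset.univ_product_univ, Finset.sum_product]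
    refine Finset.sum_congr rfl fun p _ ↦ ?_
    rw [← Finset.add_sum_erase _ _ (mem_univ p), if_neg (not_not_intro rfl), zero_add]
    exact Finset.sum_congr rfl fun q hq ↦ (if_pos (ne_of_mem_erase hq).symm).symm
  rw [h1, Finset.sum_subtype ((univ : Finset (n × n)).filter (fun pq ↦ pq.1 ≠ pq.2))
    (p := fun pq : n × n ↦ pq.1 ≠ pq.2) (fun x ↦ by simp)]

/-- **The dyadic pairing in a frame**: for `B = VᵀA'V`-type data, the pairing
`Σ_pq B_pq h'_pq` (`h' = VᵀhV`) is the combination of the pairings `γ·hγ` over the directions of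
the frame `V` with the coefficients of `dyadic_pairing`. [cite: GilbargTrudinger2001, Lemma 17.13] -/
theorem frame_pairing (B V h : Matrix n n ℝ) (hB : ∀ p q, B p q = B q p) :
    ∑ p, ∑ q, B p q * (Vᵀ * h * V) p q =
      ∑ p, (B p p - ∑ q ∈ univ.erase p, |B p q|) * (dir V (Sum.inl p) ⬝ᵥ (h *ᵥ dir V (Sum.inl p))) +
      ∑ pq : OffDiag n, ((B pq.1.1 pq.1.2)⁺ *
          (dir V (Sum.inr (Sum.inl pq)) ⬝ᵥ (h *ᵥ dir V (Sum.inr (Sum.inl pq)))) +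
        (B pq.1.1 pq.1.2)⁻ *
          (dir V (Sum.inr (Sum.inr pq)) ⬝ᵥ (h *ᵥ dir V (Sum.inr (Sum.inr pq))))) := by
  rw [dyadic_pairing B (Vᵀ * h * V) hB]
  congr 1
  · exact Finset.sum_congr rfl fun p _ ↦ by rw [conj_apply]; rfl
  · -- reindex the ordered pairs `p ≠ q` by `OffDiag n`
    have hs2 : (1 / Real.sqrt 2) ^ 2 = (1 / 2 : ℝ) := by
      rw [div_pow, one_pow, Real.sq_sqrt (by norm_num)]
    have hterm : ∀ p q, (1 / 2 : ℝ) * ((B p q)⁺ * ((Vᵀ * h * V) p p + (Vᵀ * h * V) q q +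
        (Vᵀ * h * V) p q + (Vᵀ * h * V) q p) + (B p q)⁻ * ((Vᵀ * h * V) p p + (Vᵀ * h * V) q q -
        (Vᵀ * h * V) p q - (Vᵀ * h * V) q p)) =
        (B p q)⁺ * ((fun i ↦ (1 / Real.sqrt 2) * (V i p + V i q)) ⬝ᵥ
            (h *ᵥ fun i ↦ (1 / Real.sqrt 2) * (V i p + V i q))) +
        (B p q)⁻ * ((fun i ↦ (1 / Real.sqrt 2) * (V i p - V i q)) ⬝ᵥ
            (h *ᵥ fun i ↦ (1 / Real.sqrt 2) * (V i p - V i q))) := by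
      intro p q
      obtain ⟨ha, hb⟩ := pairing_add_sub h (fun i ↦ V i p) (fun i ↦ V i q) (1 / Real.sqrt 2)
      rw [ha, hb, hs2, conj_apply, conj_apply, conj_apply, conj_apply]
      ring
    simp_rw [hterm]
    rw [sum_erase_eq_sum_offDiag]
    rfl

/-! ### Pairing invariance and the shift -/

omit [DecidableEq n] in
/-- The trace pairing in coordinates. [folklore] -/
theorem pairing_eq_trace (A h : Matrix n n ℝ) : ∑ i, ∑ j, A i j * h i j = trace (A * hᵀ) := by
  simp only [trace, diag_apply, mul_apply, transpose_apply]

/-- **Pairing invariance under orthogonal conjugation**: `Σ A_ij h_ij = Σ (VᵀAV)_pq (VᵀhV)_pq`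
for `VVᵀ = 1`. [folklore] -/
theorem pairing_conj {V : Matrix n n ℝ} (hV' : V * Vᵀ = 1) (A h : Matrix n n ℝ) :
    ∑ i, ∑ j, A i j * h i j = ∑ p, ∑ q, (Vᵀ * A * V) p q * (Vᵀ * h * V) p q := by
  rw [pairing_eq_trace, pairing_eq_trace]
  have h1 : Vᵀ * A * V * (Vᵀ * h * V)ᵀ = Vᵀ * (A * hᵀ) * V := by
    rw [transpose_mul, transpose_mul, transpose_transpose]
    simp only [Matrix.mul_assoc]
    rw [← Matrix.mul_assoc V Vᵀ, hV', Matrix.one_mul]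
  rw [h1, Matrix.trace_mul_cycle, ← Matrix.mul_assoc, hV', Matrix.one_mul]

omit [DecidableEq n] in
/-- The pairing of a dyad `γ⊗γ` with `h` is `γ·hγ`. [folklore] -/
theorem pairing_vecMulVec (γ : n → ℝ) (h : Matrix n n ℝ) :
    ∑ i, ∑ j, vecMulVec γ γ i j * h i j = γ ⬝ᵥ (h *ᵥ γ) := by
  simp only [vecMulVec_apply, dotProduct, mulVec, Finset.mul_sum]
  exact Finset.sum_congr rfl fun i _ ↦ Finset.sum_congr rfl fun j _ ↦ by ring

omit [DecidableEq n] in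
/-- The quadratic form of a dyad: `x·(γ⊗γ)x = (γ·x)²`. [folklore] -/
theorem dotProduct_vecMulVec_mulVec (γ x : n → ℝ) :
    x ⬝ᵥ (vecMulVec γ γ *ᵥ x) = (γ ⬝ᵥ x) ^ 2 := by
  simp only [dotProduct, mulVec, vecMulVec_apply, Finset.mul_sum, sq, Finset.sum_mul]
  rw [Finset.sum_comm]
  exact Finset.sum_congr rfl fun i _ ↦ Finset.sum_congr rfl fun j _ ↦ by ring

omit [DecidableEq n] in
/-- Cauchy–Schwarz for a unit vector: `(γ·x)² ≤ x·x` when `γ·γ = 1`. [folklore] -/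
theorem sq_dotProduct_le_of_unit {γ : n → ℝ} (hγ : γ ⬝ᵥ γ = 1) (x : n → ℝ) :
    (γ ⬝ᵥ x) ^ 2 ≤ x ⬝ᵥ x := by
  have h := Finset.sum_mul_sq_le_sq_mul_sq univ γ x
  simp only [dotProduct] at hγ ⊢
  have hγ' : ∑ i, γ i ^ 2 = 1 := by simpa [sq] using hγ
  rw [hγ', one_mul] at h
  simpa [sq] using h

/-! ### The Motzkin–Wasow lemma in pairing form -/
set_option maxHeartbeats 400000 in -- buildfix (bf3-g26): 160k/180k FAIL, 200k PASS at accept time; line-neutral budget line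
/-- **Motzkin–Wasow / Gilbarg–Trudinger Lemma 17.13 (pairing form).** For `0 < λ ≤ Λ` there are
a finite set `t` of orthogonal frames containing `1` and constants `0 < λ* ≤ Λ*`, depending only
on `n, λ, Λ`, such that every symmetric `𝒜` with `λ(x·x) ≤ x·𝒜x ≤ Λ(x·x)` satisfies
`Σ_{ij} 𝒜_ij h_ij = Σ_k β_k (γ_k · hγ_k)` for all `h`, with the FIXED unit directions
`γ_k = dir V s` (`V ∈ t`; columns `Ve_p` and `(Ve_p ± Ve_q)/√2` — for `V = 1` these are `e_i`
and `(e_i ± e_j)/√2`) and coefficients `λ* ≤ β_k ≤ Λ*`. Equivalently `𝒜 = Σ β_k γ_k⊗γ_k`.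
[cite: GilbargTrudinger2001, Lemma 17.13, pp. 456 and 462] [cite: MotzkinWasow1952] -/
theorem motzkinWasow_pairing [Nonempty n] {lam Lam : ℝ} (hlam : 0 < lam) (hlamLam : lam ≤ Lam) :
    ∃ (t : Finset (Matrix n n ℝ)) (lamS LamS : ℝ), (1 : Matrix n n ℝ) ∈ t ∧
      (∀ V ∈ t, Vᵀ * V = 1) ∧ 0 < lamS ∧ lamS ≤ LamS ∧
      ∀ A : Matrix n n ℝ, A.IsSymm →
        (∀ x : n → ℝ, lam * (x ⬝ᵥ x) ≤ x ⬝ᵥ (A *ᵥ x) ∧ x ⬝ᵥ (A *ᵥ x) ≤ Lam * (x ⬝ᵥ x)) →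
        ∃ β : ↥t × (n ⊕ OffDiag n ⊕ OffDiag n) → ℝ, (∀ k, lamS ≤ β k ∧ β k ≤ LamS) ∧
          ∀ h : Matrix n n ℝ, ∑ i, ∑ j, A i j * h i j =
            ∑ k : ↥t × (n ⊕ OffDiag n ⊕ OffDiag n), β k * (dir (k.1 : Matrix n n ℝ) k.2 ⬝ᵥ
              (h *ᵥ dir (k.1 : Matrix n n ℝ) k.2)) := by
  classical
  -- constants
  set N : ℝ := (Fintype.card n : ℝ) with hN
  have hN1 : 1 ≤ N := by rw [hN]; exact_mod_cast Fintype.card_pos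
  have hLam : 0 < Lam := hlam.trans_le hlamLam
  set ε : ℝ := lam / (48 * Lam * N ^ 2 + 16 * lam * N + 16) with hε
  have hden : 0 < 48 * Lam * N ^ 2 + 16 * lam * N + 16 := by positivity
  have hε0 : 0 < ε := div_pos hlam hden
  have hNε : N * ε ≤ 1 := by
    rw [hε, mul_div_assoc', div_le_one hden]; nlinarith
  have hkey : 3 * Lam * N ^ 2 * ε ≤ lam / 16 := by
    rw [hε, mul_div_assoc', div_le_div_iff₀ hden (by norm_num : (0:ℝ) < 16)]
    nlinarith [mul_nonneg (mul_nonneg hlam.le hlam.le) (zero_le_one.trans hN1), hlam.le]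
  -- the net
  obtain ⟨t, h1t, ht, hnet⟩ := exists_finite_net_orthogonal (n := n) hε0 1 (by simp)
  set K := ↥t × (n ⊕ OffDiag n ⊕ OffDiag n)
  set NK : ℝ := (Fintype.card K : ℝ) with hNK
  set lamS : ℝ := lam / (2 * NK + 2) with hlamS
  have hNK0 : 0 ≤ NK := by positivity
  have hlamS0 : 0 < lamS := div_pos hlam (by positivity)
  have hlamSK : lamS * NK ≤ lam / 2 := by
    rw [hlamS, div_mul_eq_mul_div, div_le_div_iff₀ (by positivity) (by norm_num : (0:ℝ) < 2)]
    nlinarith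
  set LamS : ℝ := lamS + Lam + lam with hLamS
  refine ⟨t, lamS, LamS, h1t, ht, hlamS0, by rw [hLamS]; linarith, fun A hA hform ↦ ?_⟩
  -- the shift `A' = A − λ* Σ_k γ_k ⊗ γ_k`
  set γ : K → (n → ℝ) := fun k ↦ dir (k.1 : Matrix n n ℝ) k.2 with hγ
  have hγu : ∀ k, γ k ⬝ᵥ γ k = 1 := fun k ↦ dir_unit (ht _ k.1.2) k.2
  set M : Matrix n n ℝ := ∑ k, vecMulVec (γ k) (γ k) with hM
  set A' : Matrix n n ℝ := A - lamS • M with hA'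
  have hMs : M.IsSymm := by
    rw [Matrix.IsSymm, hM, transpose_sum]
    exact Finset.sum_congr rfl fun k _ ↦ by ext i j; simp [vecMulVec_apply, mul_comm]
  have hA's : A'.IsSymm := by
    rw [Matrix.IsSymm, hA', transpose_sub, transpose_smul, hA.eq, hMs.eq]
  have hMform : ∀ x, 0 ≤ x ⬝ᵥ (M *ᵥ x) ∧ x ⬝ᵥ (M *ᵥ x) ≤ NK * (x ⬝ᵥ x) := fun x ↦ by
    have hq : x ⬝ᵥ (M *ᵥ x) = ∑ k, (γ k ⬝ᵥ x) ^ 2 := by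
      rw [hM, Matrix.sum_mulVec, dotProduct_sum]
      exact Finset.sum_congr rfl fun k _ ↦ dotProduct_vecMulVec_mulVec _ _
    rw [hq]
    refine ⟨Finset.sum_nonneg fun k _ ↦ sq_nonneg _, ?_⟩
    calc ∑ k, (γ k ⬝ᵥ x) ^ 2 ≤ ∑ _k : K, x ⬝ᵥ x :=
          Finset.sum_le_sum fun k _ ↦ sq_dotProduct_le_of_unit (hγu k) x
      _ = NK * (x ⬝ᵥ x) := by rw [sum_const, nsmul_eq_mul, Finset.card_univ, hNK]
  have hform' : ∀ x, lam / 2 * (x ⬝ᵥ x) ≤ x ⬝ᵥ (A' *ᵥ x) ∧ x ⬝ᵥ (A' *ᵥ x) ≤ Lam * (x ⬝ᵥ x) := by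
    intro x
    have hx : 0 ≤ x ⬝ᵥ x := by rw [dotProduct_self_eq_sum_sq]; positivity
    have hq : x ⬝ᵥ (A' *ᵥ x) = x ⬝ᵥ (A *ᵥ x) - lamS * (x ⬝ᵥ (M *ᵥ x)) := by
      rw [hA', sub_mulVec, dotProduct_sub, smul_mulVec, dotProduct_smul, smul_eq_mul]
    rw [hq]
    obtain ⟨hl, hu⟩ := hform x
    obtain ⟨hm0, hm1⟩ := hMform x
    constructor
    · have : lamS * (x ⬝ᵥ (M *ᵥ x)) ≤ lam / 2 * (x ⬝ᵥ x) :=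
        (mul_le_mul_of_nonneg_left hm1 hlamS0.le).trans (by
          rw [← mul_assoc]; exact mul_le_mul_of_nonneg_right hlamSK hx)
      linarith
    · nlinarith
  -- eigenframe of `A'`, a net frame, near-diagonalisation
  obtain ⟨U, d, hU, hU', hd, hAU⟩ := exists_orthogonal_diagonalization A' hA's hform'
  obtain ⟨V, hVt, hUV⟩ := hnet U hU
  have hV : Vᵀ * V = 1 := ht V hVt
  have hV' : V * Vᵀ = 1 := mul_eq_one_comm.1 hV
  set B : Matrix n n ℝ := Vᵀ * A' * V with hBdef
  have hBt : Bᵀ = B := by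
    rw [hBdef, transpose_mul, transpose_mul, transpose_transpose, hA's.eq, Matrix.mul_assoc]
  have hBs : ∀ p q, B p q = B q p := fun p q ↦ by
    calc B p q = Bᵀ q p := rfl
      _ = B q p := by rw [hBt]
  -- entry bounds for `B`
  have hdΛ : ∀ k, |d k| ≤ Lam := fun k ↦ by
    rw [abs_of_pos (by linarith [(hd k).1])]; exact (hd k).2
  set η : ℝ := Lam * (2 * (N * ε) + N * (N * ε) ^ 2) with hη
  have hnd : ∀ p q, |B p q - diagonal d p q| ≤ η := fun p q ↦
    near_diagonal hU hV hdΛ hε0.le (fun i j ↦ (hUV i j).le) hAU p q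
  have hN2ε : N ^ 2 * ε ≤ 1 := by
    rw [hε, mul_div_assoc', div_le_one hden]
    nlinarith [mul_le_mul_of_nonneg_left hlamLam (sq_nonneg N), hlam.le, hN1]
  have hNε0 : 0 ≤ N * ε := by positivity
  have hη3 : η ≤ 3 * Lam * (N * ε) := by
    have h1 : N * (N * ε) ^ 2 ≤ N * ε := by
      have : N * (N * ε) ^ 2 = (N ^ 2 * ε) * (N * ε) := by ring
      rw [this]
      exact (mul_le_mul_of_nonneg_right hN2ε hNε0).trans (by rw [one_mul])
    rw [hη]; nlinarith
  have hNη : N * η ≤ lam / 16 := by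
    calc N * η ≤ N * (3 * Lam * (N * ε)) := mul_le_mul_of_nonneg_left hη3 (by positivity)
      _ = 3 * Lam * N ^ 2 * ε := by ring
      _ ≤ lam / 16 := hkey
  have hη0 : 0 ≤ η := (abs_nonneg _).trans (hnd (Classical.arbitrary n) (Classical.arbitrary n))
  have hηN : η ≤ N * η := le_mul_of_one_le_left hη0 hN1
  have hdiagB : ∀ p, lam / 2 - η ≤ B p p ∧ B p p ≤ Lam + η := fun p ↦ by
    have h := abs_le.1 (hnd p p)
    rw [diagonal_apply_eq] at h
    constructor <;> linarith [(hd p).1, (hd p).2]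
  have hoffB : ∀ p q, p ≠ q → |B p q| ≤ η := fun p q hpq ↦ by
    have h := hnd p q
    rwa [diagonal_apply_ne _ hpq, sub_zero] at h
  have hrow : ∀ p, ∑ q ∈ univ.erase p, |B p q| ≤ N * η := fun p ↦ by
    calc ∑ q ∈ univ.erase p, |B p q| ≤ ∑ _q ∈ univ.erase p, η :=
          Finset.sum_le_sum fun q hq ↦ hoffB p q (ne_of_mem_erase hq).symm
      _ = ((univ.erase p).card : ℝ) * η := by rw [sum_const, nsmul_eq_mul]
      _ ≤ N * η := by
          refine mul_le_mul_of_nonneg_right ?_ hη0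
          rw [hN]; exact_mod_cast (Finset.card_erase_le).trans (Finset.card_univ (α := n)).le
  -- the coefficients in the frame `V`
  set coef : n ⊕ OffDiag n ⊕ OffDiag n → ℝ := fun s ↦ match s with
    | Sum.inl p => B p p - ∑ q ∈ univ.erase p, |B p q|
    | Sum.inr (Sum.inl pq) => (B pq.1.1 pq.1.2)⁺
    | Sum.inr (Sum.inr pq) => (B pq.1.1 pq.1.2)⁻ with hcoef
  have hcoef_bd : ∀ s, 0 ≤ coef s ∧ coef s ≤ Lam + lam := by
    rintro (p | ⟨⟨p, q⟩, hpq⟩ | ⟨⟨p, q⟩, hpq⟩)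
    · simp only [hcoef]
      obtain ⟨h1, h2⟩ := hdiagB p
      have h3 := hrow p
      have h4 : 0 ≤ ∑ q ∈ univ.erase p, |B p q| := Finset.sum_nonneg fun q _ ↦ abs_nonneg _
      constructor <;> nlinarith [hηN]
    · simp only [hcoef]
      refine ⟨posPart_nonneg _, ?_⟩
      calc (B p q)⁺ ≤ |B p q| := by
            linarith [posPart_add_negPart (B p q), negPart_nonneg (B p q)]
        _ ≤ η := hoffB p q hpq
        _ ≤ Lam + lam := by nlinarith [hηN]
    · simp only [hcoef]
      refine ⟨negPart_nonneg _, ?_⟩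
      calc (B p q)⁻ ≤ |B p q| := by
            linarith [posPart_add_negPart (B p q), posPart_nonneg (B p q)]
        _ ≤ η := hoffB p q hpq
        _ ≤ Lam + lam := by nlinarith [hηN]
  -- the representation
  refine ⟨fun k ↦ lamS + if (k.1 : Matrix n n ℝ) = V then coef k.2 else 0, fun k ↦ ?_, fun h ↦ ?_⟩
  · show lamS ≤ (lamS + if (k.1 : Matrix n n ℝ) = V then coef k.2 else 0) ∧
      (lamS + if (k.1 : Matrix n n ℝ) = V then coef k.2 else 0) ≤ LamS
    by_cases hk : (k.1 : Matrix n n ℝ) = V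
    · rw [if_pos hk]; have := hcoef_bd k.2; rw [hLamS]; constructor <;> linarith
    · rw [if_neg hk, add_zero, hLamS]; constructor <;> linarith
  · -- `Σ A h = Σ A' h + λ* Σ_k γ_k·hγ_k`
    have hsplit : ∑ i, ∑ j, A i j * h i j =
        ∑ i, ∑ j, A' i j * h i j + lamS * ∑ k : K, γ k ⬝ᵥ (h *ᵥ γ k) := by
      have hAeq : ∀ i j, A i j = A' i j + lamS * M i j := fun i j ↦ by
        rw [hA', Matrix.sub_apply, Matrix.smul_apply, smul_eq_mul]; ring
      have hMh : ∑ i, ∑ j, M i j * h i j = ∑ k : K, γ k ⬝ᵥ (h *ᵥ γ k) := by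
        calc ∑ i, ∑ j, M i j * h i j = ∑ i, ∑ j, ∑ k : K, vecMulVec (γ k) (γ k) i j * h i j := by
              refine Finset.sum_congr rfl fun i _ ↦ Finset.sum_congr rfl fun j _ ↦ ?_
              rw [hM, Matrix.sum_apply, Finset.sum_mul]
          _ = ∑ i, ∑ k : K, ∑ j, vecMulVec (γ k) (γ k) i j * h i j :=
              Finset.sum_congr rfl fun i _ ↦ Finset.sum_comm
          _ = ∑ k : K, ∑ i, ∑ j, vecMulVec (γ k) (γ k) i j * h i j := Finset.sum_comm
          _ = ∑ k : K, γ k ⬝ᵥ (h *ᵥ γ k) := Finset.sum_congr rfl fun k _ ↦ pairing_vecMulVec _ _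
      calc ∑ i, ∑ j, A i j * h i j = ∑ i, ∑ j, (A' i j * h i j + lamS * (M i j * h i j)) := by
            refine Finset.sum_congr rfl fun i _ ↦ Finset.sum_congr rfl fun j _ ↦ ?_
            rw [hAeq]; ring
        _ = ∑ i, ∑ j, A' i j * h i j + lamS * ∑ i, ∑ j, M i j * h i j := by
            simp only [Finset.sum_add_distrib, Finset.mul_sum]
        _ = _ := by rw [hMh]
    -- `Σ A' h` in the frame `V`
    have hframe : ∑ i, ∑ j, A' i j * h i j =
        ∑ s : n ⊕ OffDiag n ⊕ OffDiag n, coef s * (dir V s ⬝ᵥ (h *ᵥ dir V s)) := by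
      rw [pairing_conj hV' A' h, frame_pairing B V h hBs, Fintype.sum_sum_type, Fintype.sum_sum_type,
        ← Finset.sum_add_distrib]
    -- the right-hand side
    have hrhs : ∑ k : K, (lamS + if (k.1 : Matrix n n ℝ) = V then coef k.2 else 0) *
          (dir (k.1 : Matrix n n ℝ) k.2 ⬝ᵥ (h *ᵥ dir (k.1 : Matrix n n ℝ) k.2)) =
        lamS * ∑ k : K, γ k ⬝ᵥ (h *ᵥ γ k) +
          ∑ s : n ⊕ OffDiag n ⊕ OffDiag n, coef s * (dir V s ⬝ᵥ (h *ᵥ dir V s)) := by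
      simp only [add_mul, Finset.sum_add_distrib, Finset.mul_sum, hγ]
      congr 1
      rw [Fintype.sum_prod_type]
      rw [Finset.sum_eq_single (⟨V, hVt⟩ : ↥t)]
      · simp
      · intro W _ hW
        have : (W : Matrix n n ℝ) ≠ V := fun hh ↦ hW (Subtype.ext hh)
        simp [this]
      · intro hh; exact absurd (Finset.mem_univ _) hh
    rw [hrhs, hsplit, hframe, add_comm]


end Literature.Analysis.Matrix.MotzkinWasow

end
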